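import Mathlib.NumberTheory.ArithmeticFunction.Misc
import Mathlib.Analysis.SpecialFunctions.Log.Basic
import Mathlib.Analysis.SumIntegralComparisons
import Literature.NumberTheory.Sieve.ShiuTheoremProofs
import HarnessLib

/-!
# Elementary divisor-sum bounds for Heath-Brown's Lemma 11: `∑_{d≤Δ} τ(d) ≤ Δ(1 + log Δ)`,
# `σ(d) ≤ d(1 + log d)`, `∑_{r≤Q} w(r)/r ≤ W(1 + log Q)`

Topic `Literature/NumberTheory/Sieve`; a PROVED elementary layer (no named facts) under the named fact
`Irving2015_largestPrimeFactor_cubic` (`LargestPrimeFactorCubic.lean`), inputs of Heath-Brown's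
**Lemma 11** (main-term programme, Lemma 7): D. R. Heath-Brown, *The largest prime factor of
`X³ + 2`*, Proc. London Math. Soc. (3) 82 (2001) 554–596, §7 pp. 25–27, where the sums over `d ≤ Δ`
and over the ideals `S` with `N(S) ∣ d` are absorbed into factors `N^ε` ("`≪ ∑_{d≤Δ} ∑_{N(S)∣d}
(M/d + Q/N(S)) N^ε ≪ Δ(M + Q)N^{2ε}`", p. 26; "`≪ M²Δ⁻¹(log N)²`", (7.5)).  In root language the
multiplicities are `∑_{s∣d} 1 = τ(d)` and `∑_{s∣d} s = σ(d)`; we PROVE the logarithmic bounds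
that replace `N^ε` at these places:

* `sum_Icc_card_divisors_le` — `∑_{1≤d≤Δ} τ(d) ≤ Δ(1 + log Δ)` (Dirichlet: `= ∑_{s≤Δ} ⌊Δ/s⌋`);
* `sigma_one_le` — `σ(d) ≤ d(1 + log d)` (`d ≥ 1`);
* `sum_Icc_div_le_mul_log` — `∑_{1≤r≤Q} w(r)/r ≤ W(1 + log Q)` when `0 ≤ w ≤ W`.

## References

* D. R. Heath-Brown, *The largest prime factor of `X³ + 2`*, Proc. London Math. Soc. (3) 82 (2001)
  554–596, §7 pp. 25–27. [`HeathBrown2001LargestPrimeFactorCubic`]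

## Mathlib / tree search

Tree: `Shiu.sum_Icc_inv_le_one_add_log` (`ShiuTheoremProofs`).  Mathlib: `ArithmeticFunction.sum_Ioc_sigma0_eq_sum_div`, `ArithmeticFunction.sigma_zero_apply`,
`Nat.cast_div_le`, `Nat.sum_div_divisors`.
-/

noncomputable section

open Finset ArithmeticFunction
open scoped ArithmeticFunction.sigma

namespace Literature.NumberTheory.Sieve.HeathBrown2001

-- `∑_{i≤n} 1/i ≤ 1 + log n` in `Finset.Icc` form is the tree's `Shiu.sum_Icc_inv_le_one_add_log`.

/-- **`∑_{1 ≤ d ≤ Δ} τ(d) ≤ Δ (1 + log Δ)`** (Dirichlet's `∑_{d≤Δ} τ(d) = ∑_{s≤Δ} ⌊Δ/s⌋`).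
[cite: HeathBrown2001LargestPrimeFactorCubic, §7 p. 26 ("∑_{d≤Δ} ∑_{N(S)∣d}")] -/
theorem sum_Icc_card_divisors_le (Δ : ℕ) :
    ∑ d ∈ Icc 1 Δ, (#d.divisors : ℝ) ≤ Δ * (1 + Real.log Δ) := by
  have h := sum_Ioc_sigma0_eq_sum_div Δ
  have e1 : ∑ d ∈ Icc 1 Δ, (#d.divisors : ℝ) = ((∑ n ∈ Ioc 0 Δ, σ 0 n : ℕ) : ℝ) := by
    push_cast
    rw [show Ioc 0 Δ = Icc 1 Δ by ext d; simp only [mem_Ioc, mem_Icc]; omega]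
    exact sum_congr rfl fun d _ => by rw [sigma_zero_apply]
  rw [e1, h]
  push_cast
  calc ∑ n ∈ Ioc 0 Δ, ((Δ / n : ℕ) : ℝ) ≤ ∑ n ∈ Ioc 0 Δ, (Δ : ℝ) * (1 / n) := by
        refine sum_le_sum fun n _ => ?_
        rw [mul_one_div]; exact Nat.cast_div_le
    _ = Δ * ∑ n ∈ Icc 1 Δ, (1 : ℝ) / n := by
        rw [mul_sum, show Ioc 0 Δ = Icc 1 Δ by ext d; simp only [mem_Ioc, mem_Icc]; omega]
    _ ≤ Δ * (1 + Real.log Δ) := by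
        gcongr; exact Shiu.sum_Icc_inv_le_one_add_log Δ

/-- **`σ(d) ≤ d (1 + log d)`** for `d ≥ 1` (`σ(d) = ∑_{s∣d} d/s`).
[cite: HeathBrown2001LargestPrimeFactorCubic, §7 p. 26] -/
theorem sigma_one_le {d : ℕ} (hd : 0 < d) : ((∑ s ∈ d.divisors, s : ℕ) : ℝ) ≤ d * (1 + Real.log d) := by
  rw [← Nat.sum_div_divisors d (fun s => s)]
  push_cast
  calc ∑ s ∈ d.divisors, ((d / s : ℕ) : ℝ) ≤ ∑ s ∈ d.divisors, (d : ℝ) * (1 / s) := by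
        refine sum_le_sum fun s _ => ?_
        rw [mul_one_div]; exact Nat.cast_div_le
    _ ≤ ∑ s ∈ Icc 1 d, (d : ℝ) * (1 / s) := by
        refine sum_le_sum_of_subset_of_nonneg (fun s hs => ?_) fun _ _ _ => by positivity
        rw [mem_Icc]; rw [Nat.mem_divisors] at hs
        exact ⟨Nat.pos_of_dvd_of_pos hs.1 hd, Nat.le_of_dvd hd hs.1⟩
    _ = d * ∑ s ∈ Icc 1 d, (1 : ℝ) / s := by rw [mul_sum]
    _ ≤ d * (1 + Real.log d) := by gcongr; exact Shiu.sum_Icc_inv_le_one_add_log d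

/-- **`∑_{1≤r≤Q} w(r)/r ≤ W (1 + log Q)`** for `0 ≤ w ≤ W`. [folklore] -/
theorem sum_Icc_div_le_mul_log {Q : ℕ} {w : ℕ → ℝ} {W : ℝ} (hw : ∀ r ∈ Icc 1 Q, w r ≤ W) (hW : 0 ≤ W) :
    ∑ r ∈ Icc 1 Q, w r / r ≤ W * (1 + Real.log Q) := by
  calc ∑ r ∈ Icc 1 Q, w r / r ≤ ∑ r ∈ Icc 1 Q, W * (1 / (r : ℝ)) := by
        refine sum_le_sum fun r hr => ?_
        rw [mul_one_div]
        exact div_le_div_of_nonneg_right (hw r hr) (Nat.cast_nonneg _)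
    _ = W * ∑ r ∈ Icc 1 Q, (1 : ℝ) / r := by rw [mul_sum]
    _ ≤ W * (1 + Real.log Q) := by gcongr; exact Shiu.sum_Icc_inv_le_one_add_log Q

end Literature.NumberTheory.Sieve.HeathBrown2001
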